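import Summits.RiemannHypothesis.RiemannHypothesis.Theorems.WeilGroundStateGroundStatesConvergeToXiStubMellinDivide
import Mathlib.Analysis.Calculus.IteratedDeriv.Lemmas
import HarnessLib

/-!
# `WeilGroundState.GroundStatesConvergeToXi` — dividing the Mellin transform by a zero,
strong (all-derivatives) exponential class
(crux item stmt-RiemannHypothesis-1527, route route-RiemannHypothesis-WeilGroundState; line `Sketch`,
stub `stub_mellin_divide_strong` (K2); `--supports`)

STRONG EXPONENTIAL WEIL CLASS with rate `b₀ > 1/2`: `F : ℝ → ℂ` smooth with
`‖F^{(k)}(t)‖ ≤ C_k e^{-b₀|t|}` for every `k`.  If `F̂(s₀) = weilMellin F s₀ = 0` for some `s₀`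
in the open critical strip, `stub_mellin_divide` produces a smooth `G` with `G' = -w G - F`
(`w = s₀ - 1/2`), `‖G‖ ≤ C' e^{-b₀|t|}` and `F̂(s) = (s - s₀) Ĝ(s)` in the closed strip.  The
all-orders envelope for `G` follows from the recursion `G^{(k+1)} = -w G^{(k)} - F^{(k)}`
(`iteratedDeriv_succ'` and linearity of `iteratedDeriv k`) by induction on `k`.

No new definitions; no named fact is used.
-/

noncomputable section

set_option linter.dupNamespace false

open scoped Topology Real
open Filter Set MeasureTheory Complex

namespace Summit.RiemannHypothesis.RiemannHypothesis.Theorems.GroundStatesConvergeToXi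

open Literature.NumberTheory.LFunctions

/-- Recursion for the iterated derivatives of a smooth solution of `G' = -w G - F`:
`G^{(k+1)} = -w G^{(k)} - F^{(k)}`. [folklore] -/
theorem mdivS_iteratedDeriv_succ_eq {F G : ℝ → ℂ} {w : ℂ} (hF : ContDiff ℝ (⊤ : ℕ∞) F)
    (hG : ContDiff ℝ (⊤ : ℕ∞) G) (hode : ∀ t, deriv G t = -w * G t - F t) (k : ℕ) (t : ℝ) :
    iteratedDeriv (k + 1) G t = -w * iteratedDeriv k G t - iteratedDeriv k F t := by
  have hd : deriv G = fun u => -w * G u - F u := funext hode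
  have hGk : ContDiffAt ℝ k G t := (contDiff_infty.1 hG k).contDiffAt
  have hFk : ContDiffAt ℝ k F t := (contDiff_infty.1 hF k).contDiffAt
  have hwGk : ContDiffAt ℝ k (fun u => -w * G u) t := contDiffAt_const.mul hGk
  rw [iteratedDeriv_succ', hd, iteratedDeriv_fun_sub hwGk hFk, iteratedDeriv_const_mul_field]

/-- All-orders exponential envelope for a smooth solution of `G' = -w G - F`: if every
derivative of `F` and `G` itself are `O(e^{-b₀|t|})`, so is every derivative of `G`. [folklore] -/
theorem mdivS_allBounds {F G : ℝ → ℂ} {w : ℂ} {b₀ : ℝ} (hF : ContDiff ℝ (⊤ : ℕ∞) F)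
    (hG : ContDiff ℝ (⊤ : ℕ∞) G) (hode : ∀ t, deriv G t = -w * G t - F t)
    (hFb : ∀ k : ℕ, ∃ C : ℝ, ∀ t : ℝ, ‖iteratedDeriv k F t‖ ≤ C * Real.exp (-(b₀ * |t|)))
    (hG0 : ∃ C : ℝ, ∀ t : ℝ, ‖G t‖ ≤ C * Real.exp (-(b₀ * |t|))) :
    ∀ k : ℕ, ∃ C : ℝ, ∀ t : ℝ, ‖iteratedDeriv k G t‖ ≤ C * Real.exp (-(b₀ * |t|)) := by
  intro k
  induction k with
  | zero => simpa only [iteratedDeriv_zero] using hG0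
  | succ k ih =>
    obtain ⟨CG, hCG⟩ := ih
    obtain ⟨CF, hCF⟩ := hFb k
    refine ⟨‖w‖ * CG + CF, fun t => ?_⟩
    rw [mdivS_iteratedDeriv_succ_eq hF hG hode k t]
    calc ‖-w * iteratedDeriv k G t - iteratedDeriv k F t‖
        ≤ ‖-w * iteratedDeriv k G t‖ + ‖iteratedDeriv k F t‖ := norm_sub_le _ _
      _ = ‖w‖ * ‖iteratedDeriv k G t‖ + ‖iteratedDeriv k F t‖ := by rw [norm_mul, norm_neg]
      _ ≤ ‖w‖ * (CG * Real.exp (-(b₀ * |t|))) + CF * Real.exp (-(b₀ * |t|)) :=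
          add_le_add (mul_le_mul_of_nonneg_left (hCG t) (norm_nonneg _)) (hCF t)
      _ = (‖w‖ * CG + CF) * Real.exp (-(b₀ * |t|)) := by ring

/-- **Dividing the Mellin transform by a zero, strong class.** If `F` is smooth with
`‖F^{(k)}(t)‖ ≤ C_k e^{-b₀|t|}` for all `k` (`b₀ > 1/2`) and `F̂(s₀) = 0` for some `s₀` in the
open critical strip, then there is a smooth `G` in the same strong class with
`G' = -(s₀ - 1/2) G - F` and `F̂(s) = (s - s₀) Ĝ(s)` throughout the closed strip. [folklore] -/
theorem stub_mellin_divide_strong :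
    ∀ (F : ℝ → ℂ) (b₀ : ℝ) (s₀ : ℂ), ContDiff ℝ (⊤ : ℕ∞) F → 1 / 2 < b₀ →
      (∀ k : ℕ, ∃ C : ℝ, ∀ t : ℝ, ‖iteratedDeriv k F t‖ ≤ C * Real.exp (-(b₀ * |t|))) →
      0 < s₀.re → s₀.re < 1 → weilMellin F s₀ = 0 →
      ∃ G : ℝ → ℂ, ContDiff ℝ (⊤ : ℕ∞) G ∧
        (∀ k : ℕ, ∃ C : ℝ, ∀ t : ℝ, ‖iteratedDeriv k G t‖ ≤ C * Real.exp (-(b₀ * |t|))) ∧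
        (∀ t, deriv G t = -(s₀ - 1 / 2) * G t - F t) ∧
        ∀ s : ℂ, 0 ≤ s.re → s.re ≤ 1 → weilMellin F s = (s - s₀) * weilMellin G s := by
  intro F b₀ s₀ hF hb hbd hs0 hs1 hz
  obtain ⟨C0, hC0⟩ := hbd 0
  obtain ⟨C1, hC1⟩ := hbd 1
  obtain ⟨C2, hC2⟩ := hbd 2
  have e : ∀ t : ℝ, 0 ≤ Real.exp (-(b₀ * |t|)) := fun t => (Real.exp_pos _).le
  have h0 : ∀ t, ‖F t‖ ≤ max C0 (max C1 C2) * Real.exp (-(b₀ * |t|)) := fun t => by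
    have h := hC0 t
    rw [iteratedDeriv_zero] at h
    exact h.trans (mul_le_mul_of_nonneg_right (le_max_left _ _) (e t))
  have h1 : ∀ t, ‖deriv F t‖ ≤ max C0 (max C1 C2) * Real.exp (-(b₀ * |t|)) := fun t => by
    have h := hC1 t
    rw [iteratedDeriv_one] at h
    exact h.trans
      (mul_le_mul_of_nonneg_right ((le_max_left _ _).trans (le_max_right _ _)) (e t))
  have h2 : ∀ t, ‖deriv (deriv F) t‖ ≤ max C0 (max C1 C2) * Real.exp (-(b₀ * |t|)) :=
    fun t => by
    have h := hC2 t
    rw [iteratedDeriv_succ, iteratedDeriv_one] at h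
    exact h.trans
      (mul_le_mul_of_nonneg_right ((le_max_right _ _).trans (le_max_right _ _)) (e t))
  obtain ⟨G, hG, ⟨C', hC'⟩, hode, hmel⟩ :=
    stub_mellin_divide F (max C0 (max C1 C2)) b₀ s₀ hF hb h0 h1 h2 hs0 hs1 hz
  exact ⟨G, hG, mdivS_allBounds hF hG hode hbd ⟨C', fun t => (hC' t).1⟩, hode, hmel⟩

end Summit.RiemannHypothesis.RiemannHypothesis.Theorems.GroundStatesConvergeToXi

end
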